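import Mathlib
import Summits.Ventures.HodgeRepro.Tier4.Line2.TwistAt
import Summits.Ventures.HodgeRepro.Tier4.Line2.Witness.BranchCoefficientsWitness

/-!
# Tier4/Line2/TwistAtWitness — the R4 witness of the DEFINED twist on `(p, ℤ_[p])`

Blind re-derivation cell `pub-hodge-repro`, Tier 4, LINE L2 (seat t4-L2-p2 g4; plan-2's cut (vi) TWIST-AT
S13801, second module).  `Tier4/Line2/TwistAt.lean` defines the weight-shift twist
`O.twistAt hadic hu1 : MvPowerSeries (Fin d) O.A →ₐ[O.A] MvPowerSeries (Fin d) O.A` of a coefficient ring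
`O : BranchCoefficients` under the hypotheses `hadic : IsAdic (maximalIdeal O.A)`, `CompleteSpace O.A`,
`T2Space O.A` (the structure's uniform structure is a free field, not tied to `𝔪`).  This module shows the
hypotheses are SATISFIED on the landed R4 witness `witness p` (`A := ℤ_[p]`, p664079):

* `padicInt_coe_maximalIdeal_pow`: `𝔪^n = {x : ‖x‖ ≤ p^{-n}}` as sets (Mathlib's
  `PadicInt.norm_le_pow_iff_mem_span_pow` + `maximalIdeal_eq_span_p`);
* `padicInt_isAdic_maximalIdeal : IsAdic (IsLocalRing.maximalIdeal ℤ_[p])` — the norm topology of `ℤ_[p]` IS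
  the `𝔪`-adic topology (closed balls are open in an ultrametric space; `p^{-k} → 0`).  Not in Mathlib
  (NumberTheory/Padics has `IsAdicComplete (maximalIdeal ℤ_[p]) ℤ_[p]` only);
* `witnessTwistAt p hu1` = `(witness p).twistAt … hu1`, `witnessTwistAt_residue` = the field `twist_residue` on
  the witness, `witnessTwistAt_X`;
* NON-DEGENERACY: `witnessTwistAt_onePlusP_ne_id` — for `u i := 1 + p` (so `u i − 1 = p ∈ 𝔪`) the witness twist
  is NOT the identity (its value on `X i` has constant term `p ≠ 0`), while `witnessTwistAt_onePlusP_residue`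
  says it IS the identity mod `p`: the defined object is neither vacuous nor trivial on the witness.

Imports Mathlib + `Tier4/Line2/TwistAt` + `Tier4/Line2/Witness/BranchCoefficientsWitness`.  No printed input.
HC_CM is NOT proved by anyone in this repository.
-/

namespace Summit.Ventures.HodgeRepro.Tier4.Line2

open MvPowerSeries Filter Topology

variable (p : ℕ) [Fact p.Prime]

/-- `𝔪^n = closedBall 0 (p^{-n})` in `ℤ_[p]` (Mathlib: `maximalIdeal_eq_span_p`, `norm_le_pow_iff_mem_span_pow`). -/
theorem padicInt_coe_maximalIdeal_pow (n : ℕ) :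
    ((IsLocalRing.maximalIdeal ℤ_[p] ^ n : Ideal ℤ_[p]) : Set ℤ_[p]) =
      Metric.closedBall (0 : ℤ_[p]) ((p : ℝ) ^ (-n : ℤ)) := by
  ext x
  rw [SetLike.mem_coe, PadicInt.maximalIdeal_eq_span_p, Ideal.span_singleton_pow, Metric.mem_closedBall,
    dist_zero_right, PadicInt.norm_le_pow_iff_mem_span_pow]

/-- **The norm topology of `ℤ_[p]` is the `𝔪`-adic topology.** The powers `𝔪^n` are the closed balls of radius
`p^{-n}`, open in the ultrametric space `ℤ_[p]`, and they shrink to `0` (`PadicInt.exists_pow_neg_lt`). -/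
theorem padicInt_isAdic_maximalIdeal : IsAdic (IsLocalRing.maximalIdeal ℤ_[p]) := by
  have hp : (0 : ℝ) < p := by exact_mod_cast (Fact.out : p.Prime).pos
  rw [isAdic_iff]
  refine ⟨fun n => ?_, fun s hs => ?_⟩
  · rw [padicInt_coe_maximalIdeal_pow]
    exact IsUltrametricDist.isOpen_closedBall _ (zpow_pos hp _).ne'
  · obtain ⟨ε, hε, hεs⟩ := Metric.mem_nhds_iff.1 hs
    obtain ⟨k, hk⟩ := PadicInt.exists_pow_neg_lt p hε
    refine ⟨k, ?_⟩
    rw [padicInt_coe_maximalIdeal_pow]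
    intro x hx
    apply hεs
    rw [Metric.mem_closedBall, dist_zero_right] at hx
    rw [Metric.mem_ball, dist_zero_right]
    exact lt_of_le_of_lt hx hk

/-- The landed witness `(p, ℤ_[p])` of `BranchCoefficients` carries the `𝔪`-adic topology. -/
theorem witness_isAdic : IsAdic (IsLocalRing.maximalIdeal (witness p).A) :=
  padicInt_isAdic_maximalIdeal p

/-- **The weight-shift twist on the witness `(p, ℤ_[p])`**: `O.twistAt` instantiated with `O := witness p`
(`CompleteSpace ℤ_[p]` and `T2Space ℤ_[p]` are Mathlib's). -/
noncomputable def witnessTwistAt {d : ℕ} {u : Fin d → ℤ_[p]}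
    (hu1 : ∀ i, u i - 1 ∈ IsLocalRing.maximalIdeal ℤ_[p]) :
    MvPowerSeries (Fin d) ℤ_[p] →ₐ[ℤ_[p]] MvPowerSeries (Fin d) ℤ_[p] :=
  @BranchCoefficients.twistAt (witness p) d (witness_isAdic p) (PadicInt.completeSpace p)
    (inferInstance : T2Space ℤ_[p]) u hu1

/-- `witnessTwistAt` is `(witness p).twistAt` (definitional). -/
theorem witnessTwistAt_eq {d : ℕ} {u : Fin d → ℤ_[p]}
    (hu1 : ∀ i, u i - 1 ∈ IsLocalRing.maximalIdeal ℤ_[p]) :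
    witnessTwistAt p hu1 = @BranchCoefficients.twistAt (witness p) d (witness_isAdic p)
      (PadicInt.completeSpace p) (inferInstance : T2Space ℤ_[p]) u hu1 :=
  rfl

/-- **The field `twist_residue` on the witness**: the twist is the identity mod `p`. -/
theorem witnessTwistAt_residue {d : ℕ} {u : Fin d → ℤ_[p]}
    (hu1 : ∀ i, u i - 1 ∈ IsLocalRing.maximalIdeal ℤ_[p]) :
    ∀ F, MvPowerSeries.map (IsLocalRing.residue ℤ_[p]) (witnessTwistAt p hu1 F) =
      MvPowerSeries.map (IsLocalRing.residue ℤ_[p]) F :=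
  @BranchCoefficients.twistAt_residue (witness p) d (witness_isAdic p) (PadicInt.completeSpace p)
    (inferInstance : T2Space ℤ_[p]) u hu1

/-- The witness twist on the variables. -/
theorem witnessTwistAt_X {d : ℕ} {u : Fin d → ℤ_[p]}
    (hu1 : ∀ i, u i - 1 ∈ IsLocalRing.maximalIdeal ℤ_[p]) (i : Fin d) :
    witnessTwistAt p hu1 (X i) = C (u i) * (1 + X i) - 1 :=
  @BranchCoefficients.twistAt_X (witness p) d (witness_isAdic p) (PadicInt.completeSpace p)
    (inferInstance : T2Space ℤ_[p]) u hu1 i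

/-- `p ∈ 𝔪` in `ℤ_[p]`. -/
theorem padicInt_natCast_mem_maximalIdeal : (p : ℤ_[p]) ∈ IsLocalRing.maximalIdeal ℤ_[p] := by
  rw [PadicInt.maximalIdeal_eq_span_p]
  exact Ideal.mem_span_singleton_self _

/-- The twist units `u i := 1 + p` satisfy `u i − 1 ∈ 𝔪`. -/
theorem onePlusP_sub_one_mem (d : ℕ) :
    ∀ i : Fin d, (fun _ : Fin d => (1 + p : ℤ_[p])) i - 1 ∈ IsLocalRing.maximalIdeal ℤ_[p] := by
  intro _
  simp only [add_sub_cancel_left]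
  exact padicInt_natCast_mem_maximalIdeal p

/-- **Non-degeneracy of the witness twist**: for `u i := 1 + p` the twist sends `X i` to `p + (1 + p) X i`,
a series with constant term `p ≠ 0` — so the witness twist is NOT the identity. -/
theorem witnessTwistAt_onePlusP_ne_id {d : ℕ} (i : Fin d) :
    witnessTwistAt p (onePlusP_sub_one_mem p d) ≠ AlgHom.id ℤ_[p] (MvPowerSeries (Fin d) ℤ_[p]) := by
  intro h
  have hX := DFunLike.congr_fun h (X i)
  rw [witnessTwistAt_X, AlgHom.id_apply] at hX
  have hc := congrArg constantCoeff hX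
  simp only [map_sub, map_mul, constantCoeff_C, map_add, map_one, constantCoeff_X, add_zero, mul_one,
    add_sub_cancel_left] at hc
  exact (Nat.cast_ne_zero.2 (Fact.out : p.Prime).ne_zero) hc

/-- …while it IS the identity modulo `p` (the field `twist_residue` on the witness with `u i := 1 + p`). -/
theorem witnessTwistAt_onePlusP_residue {d : ℕ} (F : MvPowerSeries (Fin d) ℤ_[p]) :
    MvPowerSeries.map (IsLocalRing.residue ℤ_[p]) (witnessTwistAt p (onePlusP_sub_one_mem p d) F) =
      MvPowerSeries.map (IsLocalRing.residue ℤ_[p]) F :=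
  witnessTwistAt_residue p (onePlusP_sub_one_mem p d) F

end Summit.Ventures.HodgeRepro.Tier4.Line2
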